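import Literature.Probability.LatticeModels.ExplorationWinding
import Literature.Probability.LatticeModels.RandomClusterFKG
import HarnessLib

/-!
# The edge involution on the FK interface measure; s-holomorphicity needs a connected wired arc

Topic `Literature/Probability/LatticeModels`; third instalment of the discharge programme for
crit-ising.S18 (`Sweep1.lean`: Smirnov's theorem on the FK-Ising fermion), node 1 =
s-holomorphicity of the critical FK-Ising observable (Smirnov, Ann. Math. 172 (2010), Lemma 4.5,
Remark 4.6; tree: `isSHolomorphic_fkIsingObservable` in `FermionicObservable.lean`). Smirnov's
proof pairs each configuration `ω` with `ω △ {e}` for the lattice edge `e` through the vertex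
under consideration ("for the random cluster formulation it corresponds to opening/closing the
edge going through `v`") and compares the contributions of the pair, using that the
random-cluster weight changes by the loop factor `√2^{±1}`. This file provides that bookkeeping
for H21's `DiscreteDobrushin.fkInterfaceMeasure`, all proved:

* `integral_fkInterfaceMeasure`: expectations are the finite sums `∑_{ω ⊆ E} (w(ω)/Z) g(ι ω)`;
* `sum_powerset_pair`: `∑_{ω ⊆ E} f ω = ∑_{ω ⊆ E∖e} (f ω + f (ω ∪ e))` (the involution);
* `clusterCount_insert`, `rcWeight_insert`: opening `e = uv` keeps the wired cluster count if
  `u ~ v` already and lowers it by one otherwise, so `w(ω ∪ e)(1-p) q^{[u ≁ v]} = w(ω) p`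
  (from `card_connectedComponent_sup_edge_of_reachable` / `_lt` of `RandomClusterFKG.lean`);
* `rcWeight_insert_critical`: at `p_c = √2/(1+√2)`, `q = 2` the ratio is `√2` (endpoints already
  joined) or `1/√2` (two clusters merge) — `p_c/(1-p_c) = √2` (`criticalFKIsingParam_eq_sqrt_two_mul`);
* `liftConfig_insert`.

## The wired arc must be connected: a corrected statement of node 1

The weight ratio is governed by reachability **with the arc `A` wired**
(`clusterCount … (Subtype.val ⁻¹' D.zdArcA)`), whereas the rearrangement of the interface at `e`
is governed by the planar loop structure of the completed configuration `D.bcBondConfig ω`, in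
which `A` is joined up only through the open arc-`A` edges of `Ω_δ`. `IsZdAdmissible` does not
make the discrete arc `zdArcA` connected through such edges: `Ω = ` a rectangle minus a small
closed disc around one lattice site, `arcA = ` the bottom side together with the small circle,
`arcB = ` the three other sides gives admissible data (two `A`–`B` edges, each with one inner
face) whose `zdArcA` is the bottom row *plus the eight sites around the hole* — an island wired to
the arc. An exact enumeration audit (session notes of the literature-prover holding tenure on
S18, `audit/c/shol.c`: H21's `bcBondConfig`, `fkInterfaceMeasure` weights, the interface as the
`nextCorner` orbit of `MedialInterfaceProofs`, `windingAt`, `passageSum`, `cornerLine`,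
`projLine` transcribed verbatim) finds that on the `11 × 9` instance of this domain the
observable violates the projection identities of `IsSHolomorphic` at interior corners for a
positive fraction of environments of the pair `{ω, ω △ e}` (Smirnov's argument proves them
environment-wise) and in the aggregate (Monte-Carlo over environments with exact inner sums:
defect `10–16` standard errors from `0`, corner-dependent phase, so no constant `c` works), while
on every simply connected test domain (rectangles up to `11 × 9` with straight or bent arcs, an
`L`-shape) and on the same holed domain with the island in the *free* arc `B` the identities hold
exactly, environment by environment, with `arg c = 3π/8 (mod π)` for `e_a` vertical at the
bottom-right corner. Hence `isSHolomorphic_fkIsingObservable` is very probably **false as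
stated**, and the statement the printed proof supports carries the extra hypothesis

  (H1) `((discreteDomainGraph D.Ω D.δ).induce D.zdArcA).Preconnected`

(the wired arc is connected through edges of `Ω_δ`; automatic for Smirnov's simply connected
lattice domains with complementary boundary arcs). It is vendored below as the named fact
`isSHolomorphic_fkIsingObservable_of_zdArcA_connected` (a weakening of the tree's fact:
`isSHolomorphic_fkIsingObservable.of_zdArcA_connected`), to be discharged by the remaining
instalments (interface rearrangement under `ω ↦ ω △ e`, planar separation by medial loops via
`Topology/PlaneTopology/ArgumentIncrement`, and the local weight table of Lemma 4.5 with the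
windings of `ExplorationWinding.lean`).

## References

* S. Smirnov, *Conformal invariance in random cluster models. I*, Ann. Math. 172 (2010)
  1435–1467, §2.1 (`p_sd = √q/(√q+1)`, loop weight `√q`), Lemma 4.5, Remark 4.6.
* G. Grimmett, *The Random-Cluster Model* (2006), §1.2 (weights), Thm. 3.8 (edge insertion).
* D. Chelkak, S. Smirnov, Invent. Math. 189 (2012), Prop. 2.5 (s-holomorphicity, isoradial).
-/

noncomputable section

namespace Literature.Probability.LatticeModels

open MeasureTheory Finset SimpleGraph

/-! ### Adding one edge to a random-cluster configuration -/

section Weights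

variable {V : Type*} [Fintype V] [DecidableEq V] (G : SimpleGraph V) [DecidableRel G.Adj]

omit [Fintype V] in
/-- The open graph of `ω ∪ {uv}` is the open graph of `ω` with the edge `uv` added. [folklore] -/
theorem openGraph_coe_insert (ω : Finset (Sym2 V)) (u v : V) :
    Percolation.openGraph (↑(insert s(u, v) ω) : Percolation.BondConfig V) =
      Percolation.openGraph (↑ω : Percolation.BondConfig V) ⊔ edge u v := by
  ext x y
  simp only [Percolation.openGraph_adj, Finset.coe_insert, Set.mem_insert_iff, Finset.mem_coe, sup_adj,
    edge_adj, Sym2.eq_iff]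
  tauto

open scoped Classical in
/-- **Cluster count after opening one edge**: it stays the same if the endpoints were already
joined (through open edges and the wired set), and drops by one otherwise (Grimmett 2006, §1.2,
the basic edge-insertion identity behind (3.12)). [cite: Grimmett2006, §1.2] -/
theorem clusterCount_insert (ω : Finset (Sym2 V)) (u v : V) (B : Set V) :
    clusterCount (↑(insert s(u, v) ω) : Percolation.BondConfig V) B +
      (if (Percolation.openGraph (↑ω : Percolation.BondConfig V) ⊔ wired B).Reachable u v then 0 else 1) =
    clusterCount (↑ω : Percolation.BondConfig V) B := by
  unfold clusterCount
  rw [openGraph_coe_insert ω u v, sup_right_comm]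
  split_ifs with h
  · rw [add_zero, card_connectedComponent_sup_edge_of_reachable _ h]
  · have h1 := card_connectedComponent_sup_edge_lt _ h
    have h2 := card_connectedComponent_le_sup_edge_add_one (Percolation.openGraph (↑ω : Percolation.BondConfig V) ⊔ wired B) u v
    omega

open scoped Classical in
/-- **Random-cluster weights under opening one edge** `e = uv ∈ E(G) ∖ ω`:
`w(ω ∪ e) · (1 - p) · q^{[u ≁ v]} = w(ω) · p`, where `[u ≁ v] = 1` if `u`, `v` are not joined in
`ω` (with `B` wired) and `0` otherwise; i.e. `w(ω ∪ e)/w(ω) = p/(1-p)` or `p/((1-p) q)`.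
(Grimmett 2006, §1.2, eq. (1.2) and the proof of Thm. 3.8.) [cite: Grimmett2006, §1.2 eq. (1.2)] -/
theorem rcWeight_insert (p q : ℝ) (B : Set V) {ω : Finset (Sym2 V)} {u v : V}
    (he : s(u, v) ∈ G.edgeFinset) (hω : s(u, v) ∉ ω) :
    rcWeight G p q B (insert s(u, v) ω) * (1 - p) *
        q ^ (if (Percolation.openGraph (↑ω : Percolation.BondConfig V) ⊔ wired B).Reachable u v then 0 else 1) =
      rcWeight G p q B ω * p := by
  unfold rcWeight
  rw [Finset.card_insert_of_notMem hω]
  have hsd : G.edgeFinset \ insert s(u, v) ω = (G.edgeFinset \ ω).erase s(u, v) := by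
    ext e
    simp only [Finset.mem_sdiff, Finset.mem_insert, not_or, Finset.mem_erase]
    tauto
  have hmem : s(u, v) ∈ G.edgeFinset \ ω := Finset.mem_sdiff.2 ⟨he, hω⟩
  rw [hsd, Finset.card_erase_of_mem hmem]
  obtain ⟨m, hm⟩ : ∃ m, (G.edgeFinset \ ω).card = m + 1 :=
    ⟨_, (Nat.succ_pred_eq_of_pos (Finset.card_pos.2 ⟨_, hmem⟩)).symm⟩
  rw [hm, Nat.add_sub_cancel, ← clusterCount_insert ω u v B, pow_succ, pow_succ, pow_add]
  ring

end Weights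

/-! ### The critical FK-Ising edge weight: `p_c / (1 - p_c) = √2` -/

/-- `1 - p_c = 1 / (1 + √2)`. [cite: Smirnov2010, §2.1] -/
theorem one_sub_criticalFKIsingParam : 1 - criticalFKIsingParam = 1 / (1 + Real.sqrt 2) := by
  unfold criticalFKIsingParam
  have h : (0 : ℝ) < 1 + Real.sqrt 2 := by positivity
  field_simp
  ring

/-- `p_c = √2 · (1 - p_c)`: at the self-dual point the weight of an open edge relative to a closed
one is `x = p/((1-p)√q) = 1` for `q = 2`, i.e. `p/(1-p) = √2` (Smirnov 2010, §2.1,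
`p_{sd} = √q/(√q + 1)`). [cite: Smirnov2010, §2.1] -/
theorem criticalFKIsingParam_eq_sqrt_two_mul : criticalFKIsingParam = Real.sqrt 2 * (1 - criticalFKIsingParam) := by
  rw [one_sub_criticalFKIsingParam, criticalFKIsingParam]
  ring

section CriticalWeights

variable {V : Type*} [Fintype V] [DecidableEq V] (G : SimpleGraph V) [DecidableRel G.Adj]

open scoped Classical in
/-- **The critical FK-Ising weight ratio.** At `p = p_c = √2/(1+√2)`, `q = 2`, opening an edge
`e = uv ∈ E(G) ∖ ω` multiplies the random-cluster weight by `√2` if `u`, `v` were already joined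
(a loop is created: one more loop in the loop representation) and by `√2 / 2 = 1/√2` otherwise
(two clusters merge: one loop less) — the factors "since the number of cycles decreased by one"
in Smirnov's proof of Lemma 4.5 (with the loop weight `√q = √2` of §2.1).
[cite: Smirnov2010, §2.1 and proof of Lemma 4.5] -/
theorem rcWeight_insert_critical (B : Set V) {ω : Finset (Sym2 V)} {u v : V}
    (he : s(u, v) ∈ G.edgeFinset) (hω : s(u, v) ∉ ω) :
    rcWeight G criticalFKIsingParam 2 B (insert s(u, v) ω) =
      rcWeight G criticalFKIsingParam 2 B ω *
        (if (Percolation.openGraph (↑ω : Percolation.BondConfig V) ⊔ wired B).Reachable u v then Real.sqrt 2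
          else Real.sqrt 2 / 2) := by
  have key := rcWeight_insert G criticalFKIsingParam 2 B he hω
  have h1 : (0 : ℝ) < 1 - criticalFKIsingParam := by
    rw [one_sub_criticalFKIsingParam]; positivity
  have hp := criticalFKIsingParam_eq_sqrt_two_mul
  set w' := rcWeight G criticalFKIsingParam 2 B (insert s(u, v) ω)
  set w := rcWeight G criticalFKIsingParam 2 B ω
  apply mul_right_cancel₀ h1.ne'
  split_ifs at key ⊢ with h
  · rw [pow_zero, mul_one] at key
    linear_combination key + w * hp
  · rw [pow_one] at key
    linear_combination (key + w * hp) / 2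

end CriticalWeights

/-! ### The interface measure as a finite weighted sum -/

namespace DiscreteDobrushin

open scoped Classical in
/-- **Expectations under the FK interface measure are finite weighted sums**: for
`g : BondConfig → ℂ`, `∫ g dφ = ∑_{ω ⊆ E} (w(ω)/Z) g(ι ω)` over the edge sets `ω` of the interface
graph (`ι = liftConfig`), for `0 ≤ p ≤ 1`, `0 < q`. (Grimmett 2006, §1.2, eq. (1.1)–(1.3); the
measure is `fkInterfaceMeasure`, a finite combination of Dirac masses.) [cite: Grimmett2006, §1.2] -/
theorem integral_fkInterfaceMeasure (D : DiscreteDobrushin) [Fintype (meshDomain D.Ω D.δ)] {p q : ℝ}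
    (hp : p ∈ Set.Icc (0 : ℝ) 1) (hq : 0 < q) (g : Percolation.BondConfig (Site 2) → ℂ) :
    ∫ ω, g ω ∂(D.fkInterfaceMeasure p q) =
      ∑ ω ∈ D.interfaceGraph.edgeFinset.powerset,
        (rcWeight D.interfaceGraph p q (Subtype.val ⁻¹' D.zdArcA) ω /
          rcPartitionFunction D.interfaceGraph p q (Subtype.val ⁻¹' D.zdArcA)) • g (liftConfig D.Ω D.δ ω) := by
  classical
  unfold fkInterfaceMeasure
  rw [integral_finsetSum_measure]
  · refine Finset.sum_congr rfl fun ω _ => ?_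
    rw [integral_smul_measure, integral_dirac, ENNReal.toReal_ofReal]
    exact div_nonneg (rcWeight_nonneg _ hp hq.le _ ω) (rcPartitionFunction_pos _ hp hq _).le
  · intro ω _
    refine Integrable.smul_measure ?_ ENNReal.ofReal_ne_top
    exact (integrable_const (g (liftConfig D.Ω D.δ ω))).congr (ae_eq_dirac g).symm

/-- Lifting commutes with inserting an edge: `ι (ω ∪ e) = ι ω ∪ {val e}`. [cite: Smirnov2010, §2] -/
theorem _root_.Literature.Probability.LatticeModels.liftConfig_insert (Ω : Set ℂ) (δ : ℝ)
    [DecidableEq (Sym2 (meshDomain Ω δ))] (e : Sym2 (meshDomain Ω δ)) (ω : Finset (Sym2 (meshDomain Ω δ))) :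
    liftConfig Ω δ (insert e ω) = insert (e.map Subtype.val) (liftConfig Ω δ ω) := by
  rw [liftConfig, liftConfig, Finset.coe_insert, Set.image_insert_eq]

end DiscreteDobrushin

/-- **Pairing a sum over configurations by one edge**: for `e ∈ E`,
`∑_{ω ⊆ E} f ω = ∑_{ω ⊆ E ∖ e} (f ω + f (ω ∪ e))` — the involution `ω ↦ ω △ e` of Smirnov's
proof of Lemma 4.5 ("an involution on loop configurations which results from the rearrangement of
connections at the point `v`; for the random cluster formulation it corresponds to opening/closing
the edge going through `v`"). [cite: Smirnov2010, proof of Lemma 4.5] -/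
theorem sum_powerset_pair {α M : Type*} [DecidableEq α] [AddCommMonoid M] {E : Finset α} {e : α}
    (he : e ∈ E) (f : Finset α → M) :
    ∑ ω ∈ E.powerset, f ω = ∑ ω ∈ (E.erase e).powerset, (f ω + f (insert e ω)) := by
  conv_lhs => rw [← Finset.insert_erase he]
  rw [Finset.sum_powerset_insert (Finset.notMem_erase e E), Finset.sum_add_distrib]


/-! ### Node 1 of crit-ising.S18, corrected: s-holomorphicity with a connected wired arc -/

/-- **Smirnov's s-holomorphicity of the critical FK-Ising observable, for a connected wired arc**
(Smirnov, Ann. Math. 172 (2010), Lemma 4.5 with Remark 4.6: at an interior vertex the values of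
`F` at the eight neighbouring edge and corner centres are the orthogonal projections of `F(v)`,
hence `F` is preholomorphic = s-holomorphic in the sense of Def. 3.1; Chelkak–Smirnov 2012,
Prop. 2.5). For admissible Dobrushin data `D` on `δℤ²` whose discrete arc `A` is connected
through the edges of `Ω_δ` joining two of its sites — hypothesis (H1), under which the wiring of
`A` in `fkInterfaceMeasure` is realised by the (open) arc-`A` edges of the completed
configuration, as in print, where lattice domains are simply connected and the two arcs are
complementary boundary arcs — there is a constant `c ≠ 0` (a phase fixed by the direction of
the boundary edge `e_a` and the winding origin, times Smirnov's `cos (π/8)` normalisation; H21's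
`cornerLine` is orthogonal to Smirnov's line `ℓ(e)`, which `c ∈ iℝ · const` absorbs) such that
`c · F` is s-holomorphic at the interior medial vertices, `F = fkIsingObservable D p_c` (all
passages, winding from `e_a`, expectation under `D.fkInterfaceMeasure p_c 2`). This is the
tree's `isSHolomorphic_fkIsingObservable` **plus (H1)**; without (H1) the statement is very
probably false (wired islands: see the module docstring), which is why node 1 of the S18
programme is restated here under a new name rather than discharged as it stands.
[cite: Smirnov2010, Lemma 4.5 and Remark 4.6] -/
def isSHolomorphic_fkIsingObservable_of_zdArcA_connected : Prop :=
  ∀ (D : DiscreteDobrushin) (_hD : D.IsZdAdmissible) [Fintype (meshDomain D.Ω D.δ)],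
    ((discreteDomainGraph D.Ω D.δ).induce D.zdArcA).Preconnected →
    ∃ c : ℂ, c ≠ 0 ∧
      IsSHolomorphic (fun z => c * fkIsingObservable D criticalFKIsingParam z) D.innerMedialVertices

-- names the `@[deprecated]` record `isSHolomorphic_fkIsingObservable` of `FermionicObservable.lean` on
-- purpose: this IS the formal comparison old statement ⇒ corrected statement (verdict clean-up
-- 2026-08-16); REMOVE-WHEN the record is deleted from `FermionicObservable.lean` (then delete this theorem)
set_option linter.deprecated false in
/-- The tree's unconditional (misstated, now `@[deprecated]`) fact implies the corrected one
(which merely adds the hypothesis (H1)); recorded so that the two statements are formally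
comparable. [cite: Smirnov2010, Lemma 4.5] -/
theorem isSHolomorphic_fkIsingObservable.of_zdArcA_connected (h : isSHolomorphic_fkIsingObservable) :
    isSHolomorphic_fkIsingObservable_of_zdArcA_connected :=
  fun D hD _ _ => h D hD

end Literature.Probability.LatticeModels
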